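import Summits.BirchSwinnertonDyer.Rank1Residual.P2.Conjectures.CongruentNumberEvenMonskyLawAtTwo
import Summits.BirchSwinnertonDyer.Rank1Residual.P2.CongruentNumberPairsAtTwoEvenDoorDescent
import HarnessLib

/-!
# The typed uniform law C-P2-2 (`CongruentEvenBSDTwoAt k`, every `k`) WITHOUT any `2`-Selmer display:
# observable ⟺ sharper modulo GZK ONLY, and LAW ⟺ LAW-ON-SILENT-CELLS modulo {U⁺, GZK} ONLY
# (the binders `hMe` of `Conjectures/CongruentNumberEvenMonskyLawAtTwo.lean` §3–§4 and `hAo` of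
# `P2/CongruentNumberEvenAokiMonskyDoors.lean` §2 discharged by the tree's complete `2`-descent; nothing asserted)

HONEST FRAMING (cell `bsd-monsky`, run/shared/lean/pub/bsd-monsky/, README §1/§3; sub-lane «bsd-p2» vocabulary): the cell's
CLAIMED theorem is Monsky's 1990 conjecture (a)+(b) on `𝒮⁻` (`k = 2`); the typed uniform law C-P2-2 for `k ≥ 3` is a RECORD /
an `@[conjecture]` `Prop`, never asserted. Its landed bookkeeping — "sharper ⟺ observable" and "law ⟺ law on the TYZ-silent cells,
the loud cells being theorems" — was modulo {GZK, `hMe`} (the conjecture file, §3–§4) or {GZK, `hAo`} (the Aoki doors), plus U⁺ for the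
loud cells; the `2`-Selmer fact enters ONLY as `#Sel₂(E_n) = 2^{2+s(n)} = 8 ⟹ Ш[2^∞] = 0` given rank `1`. The tree now PROVES
`#Sel₂(E_{2p₁⋯p_k}) ≤ 2^{2+s}` for every `k` (`Literature/…/CongruentNumberEvenMonskySelmerBound.lean`) and the uniform even door
modulo GZK only (`rankOne_sha_bsdp_two_iff_congruentNumberCurve_two_mul_prod_descent`). THIS FILE re-runs the bookkeeping on that
door: `congruentEvenBSDTwoAt_iff_ordTwoAt_descent (hGZK)`, `congruentEvenMonskyBSDTwo_iff_ordTwo_descent (hGZK)` (§1);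
DOOR B6 over census vocabulary and `congruentEvenBSDTwoAt_iff_silent_descent (hU) (hGZK)`,
`congruentEvenMonskyBSDTwo_iff_forall_silent_descent (hU) (hGZK)` (§2) — **the whole reduction of C-P2-2 to its TYZ-silent cells now
rests on {U⁺ = TYZ Thm. 1.1/1.2 as printed, GZK} and NO `2`-Selmer display** (Monsky 1990 / HB94 / Aoki 1999 are corroboration).
CONDITIONAL on the named facts said; neither conjecture `Prop` is asserted; no count moves; no class booked; no mark moved.

References: [Monsky1990MockHeegner] Remark (3) (p. 67); [HeathBrown1994SelmerCongruentII] Appendix (Monsky), typescript p. 41 L1–L36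
(even case; upper bound a tree theorem); [TianYuanZhang2017] Thm. 1.1, Thm. 1.2, Thm. 3.5, §1 (1.1); [SilvermanAEC2009] Prop. X.1.4,
X.4.9, Thm. X.4.2; [SilvermanATAEC1994] IV.9.4, Table 4.1; [Miller2011LMS] Def. 1.1.
-/

noncomputable section

open scoped Classical

open Matrix Finset WeierstrassCurve Literature.NumberTheory.EllipticCurves
  Literature.NumberTheory.EllipticCurves.Rank1Residual
  Literature.NumberTheory.EllipticCurves.Rank1Residual.Typed
  Literature.NumberTheory.EllipticCurves.HeathBrown1994
  Literature.NumberTheory.EllipticCurves.TianYuanZhang2017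
  Literature.NumberTheory.QuadraticFields.RedeiReichardt

set_option autoImplicit false

namespace Summit.BirchSwinnertonDyer.Rank1Residual.P2

namespace Conjectures

/-! ## §1 Sharper ⟺ observable at every `k`, modulo GZK only -/

/-- **Sharper ⟹ observable at every `k`, modulo GZK ONLY** (the `2`-Selmer input is the tree's complete `2`-descent).
Asserts neither `Prop`. [cite: HeathBrown1994SelmerCongruentII, Appendix (Monsky), typescript p. 41 L20–L36]
[cite: Miller2011LMS, Def. 1.1 (arXiv:1010.2431 p. 3)] -/
theorem congruentEvenBSDTwoAt_of_ordTwoAt_descent (hGZK : rank_eq_analyticRank_of_analyticRank_le_one)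
    {k : ℕ} (h : CongruentEvenOrdTwoAt k) : CongruentEvenBSDTwoAt k := by
  intro p hp hinj h8 hs
  obtain ⟨x, hx0, hx, hv⟩ := h p hp hinj h8 hs
  obtain ⟨hr1, -, -, hiff⟩ :=
    rankOne_sha_bsdp_two_iff_congruentNumberCurve_two_mul_prod_descent p hGZK hp hinj rfl h8 hs hx0 hx
  exact ⟨hr1, hiff.mpr hv⟩

/-- **Observable ⟹ sharper at every `k`, modulo GZK ONLY** (verbatim the `hMe` proof of the conjecture file with
`#Sel₂ = 2^{2+s}` replaced by the tree theorem `#Sel₂ ≤ 2^{2+s}` and Silverman X.4.2 in the `≤ 8` form).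
[cite: HeathBrown1994SelmerCongruentII, Appendix (Monsky), typescript p. 41 L20–L36] [cite: Miller2011LMS, §1 and Def. 1.1 (arXiv:1010.2431 p. 3)]
[cite: SilvermanAEC2009, Prop. X.1.4, Prop. X.4.9, Thm. X.4.2] [cite: SilvermanATAEC1994, IV.9.4, Table 4.1] -/
theorem congruentEvenOrdTwoAt_of_bsdTwoAt_descent (hGZK : rank_eq_analyticRank_of_analyticRank_le_one)
    {k : ℕ} (h : CongruentEvenBSDTwoAt k) : CongruentEvenOrdTwoAt k := by
  intro p hp hinj h8 hs
  have hodd : ∀ i, Odd (p i) := odd_of_two_mul_prod_mod_eight_six p rfl h8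
  have hsq : Squarefree (2 * ∏ i, p i) := squarefree_two_mul_prod_of_injective p hp hodd hinj
  have hn0 : 2 * ∏ i, p i ≠ 0 := hsq.ne_zero
  haveI := isElliptic_congruentNumberCurve hn0
  haveI : Fact (Nat.Prime 2) := ⟨Nat.prime_two⟩
  obtain ⟨hr1, hbsd⟩ := h p hp hinj h8 hs
  obtain ⟨-, -, y, hy, hval⟩ := hbsd
  obtain ⟨hrank, -⟩ := hGZK (congruentNumberCurve (2 * ∏ i, p i)) (le_of_eq hr1)
  rw [hr1] at hrank
  have hsel : Nat.card ((congruentNumberCurve (2 * ∏ i, p i)).selmerGroup 2) ≤ 8 :=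
    card_selmerGroup_two_le_eight_of_monskySelmerRankEven_eq_one p hp hodd hinj hs
  have hbot := primaryComponent_sha_two_eq_bot_of_card_selmerGroup_le_eight hn0 hrank hsel
  have hcard : Nat.card
      (AddCommGroup.primaryComponent (congruentNumberCurve (2 * ∏ i, p i)).sha 2) = 1 := by
    rw [hbot]; exact AddSubgroup.card_bot
  rw [hcard, padicValNat_one_right, Nat.cast_zero] at hval
  obtain ⟨hlead, hder⟩ := leadingLCoeff_eq_deriv_of_analyticRank_eq_one hr1
  have hT := torsionOrder_congruentNumberCurve hsq
  have htam : (congruentNumberCurve (2 * ∏ i, p i)).tamagawaProduct = 2 ^ (2 * k + 2) :=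
    tamagawaProduct_congruentNumberCurve_two_mul_prod p hp hodd hinj rfl
  have hΩ : ((congruentNumberCurve (2 * ∏ i, p i)).realPeriodRat : ℂ) ≠ 0 := by
    exact_mod_cast (congruentNumberCurve (2 * ∏ i, p i)).realPeriodRat_pos_holds.ne'
  have hR : ((congruentNumberCurve (2 * ∏ i, p i)).regulator : ℂ) ≠ 0 := by
    exact_mod_cast (congruentNumberCurve (2 * ∏ i, p i)).regulator_pos'.ne'
  have h2 : (2 : ℂ) ^ (2 * k + 2) ≠ 0 := pow_ne_zero _ two_ne_zero
  have hsha := hy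
  rw [shaAn_def, hlead, hT, htam] at hsha
  push_cast at hsha
  have hderiv : deriv (congruentNumberCurve (2 * ∏ i, p i)).entireLFunction 1 =
      ((y * 2 ^ (2 * k + 2) / 16 : ℚ) : ℂ) *
        ((congruentNumberCurve (2 * ∏ i, p i)).realPeriodRat : ℂ) *
          ((congruentNumberCurve (2 * ∏ i, p i)).regulator : ℂ) := by
    rw [div_eq_iff (mul_ne_zero (mul_ne_zero hΩ h2) hR)] at hsha
    push_cast
    linear_combination (1 / 16 : ℂ) * hsha
  have hy0 : y ≠ 0 := by
    rintro rfl
    apply hder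
    rw [hderiv]; push_cast; ring
  have hy2 : y * 2 ^ (2 * k + 2) ≠ 0 := mul_ne_zero hy0 (pow_ne_zero _ two_ne_zero)
  refine ⟨y * 2 ^ (2 * k + 2) / 16, div_ne_zero hy2 (by norm_num), hderiv, ?_⟩
  rw [padicValRat.div hy2 (by norm_num), padicValRat.mul hy0 (pow_ne_zero _ two_ne_zero), hval,
    show ((2 : ℚ) ^ (2 * k + 2)) = ((2 ^ (2 * k + 2) : ℕ) : ℚ) by push_cast; rfl,
    show (16 : ℚ) = ((2 ^ 4 : ℕ) : ℚ) by norm_num, padicValRat.of_nat, padicValRat.of_nat,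
    padicValNat.prime_pow, padicValNat.prime_pow]
  push_cast
  ring

/-- **C-P2-2 at `k` primes: observable ⟺ sharper, modulo GZK ONLY.** Neither side is asserted.
[cite: HeathBrown1994SelmerCongruentII, Appendix (Monsky), typescript p. 41 L20–L36] [cite: Miller2011LMS, Def. 1.1 (arXiv:1010.2431 p. 3)] -/
theorem congruentEvenBSDTwoAt_iff_ordTwoAt_descent (hGZK : rank_eq_analyticRank_of_analyticRank_le_one) {k : ℕ} :
    CongruentEvenBSDTwoAt k ↔ CongruentEvenOrdTwoAt k :=
  ⟨congruentEvenOrdTwoAt_of_bsdTwoAt_descent hGZK, congruentEvenBSDTwoAt_of_ordTwoAt_descent hGZK⟩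

/-- **C-P2-2, uniform: `CongruentEvenMonskyBSDTwo ⟺ CongruentEvenMonskyOrdTwo`, modulo GZK ONLY.** Neither conjecture is
asserted. [cite: HeathBrown1994SelmerCongruentII, Appendix (Monsky), typescript p. 41 L20–L36] [cite: Miller2011LMS, Def. 1.1] -/
theorem congruentEvenMonskyBSDTwo_iff_ordTwo_descent (hGZK : rank_eq_analyticRank_of_analyticRank_le_one) :
    CongruentEvenMonskyBSDTwo ↔ CongruentEvenMonskyOrdTwo :=
  ⟨fun h k hk => congruentEvenOrdTwoAt_of_bsdTwoAt_descent hGZK (h k hk),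
    fun h k hk => congruentEvenBSDTwoAt_of_ordTwoAt_descent hGZK (h k hk)⟩

/-! ## §2 The loud cells and the reduction to the silent cells, modulo {U⁺, GZK} only -/

section Rule

variable (hU : ∀ (n : ℕ), Squarefree n → (n % 8 = 5 ∨ n % 8 = 6 ∨ n % 8 = 7) →
      ∃ L : ℤ, IsScriptL n L ∧
        ((n % 8 = 5 ∨ n % 8 = 7) → (2 : ℤ) ∣ L →
          Even (genusSum₁ n fun d => genusClassNumber (GenusField d)) ∧
          Even (genusSum₂' n fun d => genusClassNumber (GenusField d))) ∧
        (n % 8 = 6 → (2 : ℤ) ∣ L → Even (genusSum₂' n fun d => genusClassNumber (GenusField d))))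
include hU

/-- **DOOR B6 OVER CENSUS VOCABULARY modulo {U⁺, GZK} ONLY** (the LOUD cells `Σ₂′(n)` odd are theorems): for distinct primes
`p₁, …, p_k`, `n = 2p₁⋯p_k ≡ 6 (mod 8)`, `s(n) = 1`, `Σ₂′(n)` odd: `ord_{s=1} L = 1`, rank `1`, `Ш[2^∞] = 0`, `BSD(E_n, 2)` — U⁺ gives the
datum `L′ = 2^{2k−2}𝓛²·Ω·Reg` with `𝓛` odd, the GZK-only even door does the rest (`#Sel₂ ≤ 8` the tree's `2`-descent). CONDITIONAL on
`hU`, `hGZK`; nothing asserted. [cite: TianYuanZhang2017, Thm. 1.2, Thm. 3.5 and §1 (1.1)]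
[cite: HeathBrown1994SelmerCongruentII, Appendix (Monsky), typescript p. 41 L20–L36] [cite: Miller2011LMS, Def. 1.1 (arXiv:1010.2431 p. 3)] -/
theorem rankOne_sha_bsdp_two_congruentNumberCurve_two_mul_prod_of_odd_genusSum₂'_descent
    (hGZK : rank_eq_analyticRank_of_analyticRank_le_one)
    {k : ℕ} (p : Fin k → ℕ) (hp : ∀ i, (p i).Prime) (hinj : Function.Injective p) {n : ℕ}
    (hn : 2 * ∏ i, p i = n) (h8 : n % 8 = 6) (hs : monskySelmerRankEven p = 1)
    (hgen : Odd (genusSum₂' n fun d => genusClassNumber (GenusField d))) :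
    (congruentNumberCurve n).analyticRank = 1 ∧ (congruentNumberCurve n).mordellWeilRank = 1 ∧
      AddCommGroup.primaryComponent (congruentNumberCurve n).sha 2 = ⊥ ∧
      BSDp (congruentNumberCurve n) 2 := by
  have hodd : ∀ i, Odd (p i) := odd_of_two_mul_prod_mod_eight_six p hn h8
  have hsq : Squarefree n := hn ▸ squarefree_two_mul_prod_of_injective p hp hodd hinj
  obtain ⟨L, hLodd, -, hderiv⟩ := rankOneDatum_of_uPlus_six hU hsq h8 hgen
  have hL0 : (L : ℚ) ≠ 0 := by
    have hL0' : L ≠ 0 := fun h => by simp [h] at hLodd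
    exact_mod_cast hL0'
  have hx0 : (2 : ℚ) ^ twoExponent n * (L : ℚ) ^ 2 ≠ 0 :=
    mul_ne_zero (zpow_ne_zero _ two_ne_zero) (pow_ne_zero _ hL0)
  have hx : deriv (congruentNumberCurve n).entireLFunction 1 =
      (((2 : ℚ) ^ twoExponent n * (L : ℚ) ^ 2 : ℚ) : ℂ) *
        ((congruentNumberCurve n).realPeriodRat : ℂ) * ((congruentNumberCurve n).regulator : ℂ) := by
    rw [hderiv]; push_cast; ring
  obtain ⟨hr1, hrank, hbot, hiff⟩ :=
    rankOne_sha_bsdp_two_iff_congruentNumberCurve_two_mul_prod_descent p hGZK hp hinj hn h8 hs hx0 hx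
  refine ⟨hr1, hrank, hbot, hiff.mpr ?_⟩
  rw [padicValRat_two_zpow_mul_sq hLodd, ← hn, twoExponent_two_mul_prod_eq p hp hodd hinj]

/-- **LAW ⟺ LAW-ON-SILENT-CELLS at every `k`, modulo {U⁺, GZK} ONLY** — no `2`-Selmer display. Asserts neither side.
[cite: TianYuanZhang2017, Thm. 1.2, Thm. 3.5] [cite: HeathBrown1994SelmerCongruentII, Appendix (Monsky), typescript p. 41 L20–L36]
[cite: Miller2011LMS, Def. 1.1] -/
theorem congruentEvenBSDTwoAt_iff_silent_descent (hGZK : rank_eq_analyticRank_of_analyticRank_le_one) {k : ℕ} :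
    CongruentEvenBSDTwoAt k ↔ CongruentSilentEvenBSDTwoAt k := by
  refine ⟨congruentSilentEvenBSDTwoAt_of_bsdTwoAt, fun h p hp hinj h8 hs => ?_⟩
  rcases Nat.even_or_odd (genusSum₂' (2 * ∏ i, p i) fun d => genusClassNumber (GenusField d)) with
    hev | hod
  · exact h p hp hinj h8 hs hev
  · obtain ⟨hr1, -, -, hb⟩ :=
      rankOne_sha_bsdp_two_congruentNumberCurve_two_mul_prod_of_odd_genusSum₂'_descent hU hGZK p hp
        hinj rfl h8 hs hod
    exact ⟨hr1, hb⟩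

/-- **Uniform form of the rule modulo {U⁺, GZK} ONLY:** `CongruentEvenMonskyBSDTwo ⟺ ∀ k ≥ 2`, the silent restriction.
Asserts neither. [cite: TianYuanZhang2017, Thm. 1.2] [cite: HeathBrown1994SelmerCongruentII, Appendix (Monsky), typescript p. 41 L20–L36] -/
theorem congruentEvenMonskyBSDTwo_iff_forall_silent_descent (hGZK : rank_eq_analyticRank_of_analyticRank_le_one) :
    CongruentEvenMonskyBSDTwo ↔ ∀ k : ℕ, 2 ≤ k → CongruentSilentEvenBSDTwoAt k :=
  ⟨fun h k hk => congruentSilentEvenBSDTwoAt_of_bsdTwoAt (h k hk),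
    fun h k hk => (congruentEvenBSDTwoAt_iff_silent_descent hU hGZK).mpr (h k hk)⟩

end Rule

end Conjectures

end Summit.BirchSwinnertonDyer.Rank1Residual.P2

end
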